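import Summits.QuantumFields.BalabanUV.T4Continuum.Support.NE9FutureProfileEndOfRecord
import Summits.QuantumFields.BalabanUV.T4Continuum.Support.NE9FutureProfileReal
import Literature.Analysis.Complex.SymmetryPrincipleBanachStar

/-!
# NE9HoloSliceOfNaive — ROUTE R4's END OF RECORD for the `star`-SYMMETRISATION of a NAIVE complex slice map: the three
# instance clauses (Φ-holo) ∕ (Φ-size) ∕ (Φ-real) of `NE9FutureProfileEndOfRecord` from (Φ₀-holo) ∕ (Φ₀-size) ∕ (Φ₀-re)

Cell `pub-balaban`, T4-DAG §6 NE9; NE9 crux team (coordinator ruling e34b3e0c (2)), leaf lineage `b2b-balaban-t4-ne9-formalise-leaf-02`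
gen 32, filed on the OWNER `t4-ne9-p1` g60's word (journal l.28916: «the COMPLEMENTARY cut to D4's family∕pack form — GO, file it as a
sibling `Support/NE9HoloSliceOfNaive.lean`»); route R4 «fading by Earle–Hamilton» (`t4/ROUTES-NE9.md` §L1.0), recipe amendment (δ).
Letters as in the END of record: `Pot := lp (ι → ℂ) ∞` (weighted complex tables, `NE9TableReading.reading`), `𝔜 := lp (Bg × C.Dom → ℂ) ∞`
(the AMBIENT slice space of `NE9SliceSpaceOfRecord`); both carry Mathlib's coordinatewise `star` (complex conjugation), for which the
self-adjoint vectors are exactly the real-coordinate ones.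
HONEST FRAMING (T4-DAG PAGE 1).  Rung (B)+1 of the FINITE-VOLUME T⁴ programme — NOT infinite volume, NOT a mass gap, NOT Clay.  NE9
(`T4OutputRate.NE9` ∧ `FadingMemory`) is a cell NEW ESTIMATE, NOT PRINTED in [I] = [Balaban1987RG1] (CMP **109**), [II] =
[Balaban1988RG2Cluster] (CMP **116**), NOT PROVED for Bałaban's E^{(j)}: every theorem below is «NE9 ⇐ the named binders» for an ABSTRACT
functional, and the naive slice map's clauses (Φ₀-holo) ∕ (Φ₀-size) are the INSTANCE's burden ((R-0)[scope] on the inflated box through (♮)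
`GateauxHolomorphicBall` and (♭) `NE9EllInftyHolomorphy` — the owner's D4 `NE9HoloSliceOfFamily` ∕ D5 `NE9HoloFamilyOfPencil` cut); W1 =
model O-NE9-1 is untouched; spine 0∕9.  HONEST DEPENDENCY (cell line, verbatim): continuum YM on T⁴ ⇐ BetaPertH ∧ nine spine estimates
(0/9 proved); BetaPertH ⇐ (D1) ∧ (D4) ∧ CAP+tail; G-an2-4 gates asym, D1 and NE2/3/4.  `FlowStep.BetaPertH`, (B), (B^μ) do not occur;
[I]∕[II] for TYPES only (ABSOLUTE RULE).
WHAT IS PROVED ([folklore] bookkeeping; the analysis is the imported kernels).  With the symmetrised slice map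
`Φ₀^sym k s Q := 2⁻¹ • (Φ₀ k s Q + star (Φ₀ k s (star Q)))` of a naive complexification `Φ₀ : ℕ → ℝ → Pot → 𝔜`:
§1 CLAUSE ADAPTERS, END-agnostic (they produce exactly the `hΦd` ∕ `hΦb` ∕ `hreal` binders of the END of record, hence dock unchanged at its
√2-free and polydisc siblings): `differentiableOn_symSlice` = (Φ-holo) and `mapsTo_symSlice` = (Φ-size) with the SAME `B₀` from (Φ₀-holo) +
(Φ₀-size) (Ahlfors' symmetry principle through `star`, `SymmetryPrincipleBanachStar.symmetrise_star_lp_ball` (i)(ii)); `symSlice_reading_apply`: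
AT A RECORD TABLE `reading wt Q` (self-adjoint, `NE9FutureProfileReal.isSelfAdjoint_reading`) the symmetrised map reads coordinatewise the
REAL PART of the naive one — no holomorphy needed; `isSelfAdjoint_symSlice_reading`; `symSlice_star` (equivariance everywhere);
`hreal_symSlice` = (Φ-real) from (Φ₀-re) «the REAL PARTS of `Φ₀`'s coordinates at the record's tables are the record's new slice
`e^{κd}·(Ψ k (s k) (T k s (E g)))↾(k+1)`» (imaginary parts free — the symmetrisation kills them); `re_of_eq_ofReal` («Φ₀ extends the real
slice» ⇒ (Φ₀-re)).  §2 **`ne9_and_fadingMemory_of_naiveSlice`** — THE END: the owner's `ne9_and_fadingMemory_of_holoSlice` with its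
structural binders VERBATIM, `ΦY := Φ₀^sym`, and (Φ-holo)∕(Φ-size)∕(Φ-real) replaced by (Φ₀-holo)∕(Φ₀-size)∕(Φ₀-re); SAME room
`ω̂·r + (√2·τ̄)·B₀ ≤ θ·r`, SAME conclusion `NE9 E W κ (prodModuli ((2∕(1−θ))·ℓ) (fun _ => 2θ∕(1+θ))) ∧ FadingMemory …`.  §T: the
`.re`-form of (Φ₀-re) is strictly weaker than «Φ₀ real at real tables» (witness `Φ₀ := I • id`, whose symmetrisation vanishes at real
tables).  DISGUISE TEST: an abstract functional with displayed binders; 0 `def`, 0 sorry.  Summits-side NEW work (LEAN PLACEMENT RULE).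
References (TYPES only): [Balaban1987RG1] CMP **109** (2.13) p. 268; [Balaban1988RG2Cluster] CMP **116** (1.33)∕(1.36) p. 9; [AhlforsCA1979]
Ch. 4 §6.5 p. 172 (the symmetry principle); [EarleHamilton1970].
-/

noncomputable section

namespace Summit.QuantumFields.BalabanUV.T4Continuum.NE9HoloSliceOfNaive

open Metric Set
open scoped BigOperators ENNReal ComplexConjugate
open Literature.MathematicalPhysics.QuantumFieldTheory.Balaban1983to89
open Literature.MathematicalPhysics.QuantumFieldTheory.Balaban1983to89.T4OutputRate
open Literature.MathematicalPhysics.QuantumFieldTheory.Balaban1983to89.T4HistoryLipschitzRecursion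
open Literature.MathematicalPhysics.QuantumFieldTheory.Balaban1983to89.T4HistoryLipschitzOuter
open Summit.QuantumFields.BalabanUV.T4Continuum.NE9TableReading
open Summit.QuantumFields.BalabanUV.T4Continuum.NE9FutureProfileEndOfRecord
open Summit.QuantumFields.BalabanUV.T4Continuum.NE9FutureProfileReal
open Literature.Analysis.Complex.SymmetryPrincipleBanachStar

variable {C : Carriers} {Bg ι : Type}

/-! ## §1 The clause adapters (END-agnostic) -/

section Clauses

variable {Φ₀ : ℕ → ℝ → lp (fun _ : ι => ℂ) ∞ → lp (fun _ : Bg × C.Dom => ℂ) ∞} {W : Set (ℕ → ℝ)} {r B₀ : ℝ}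

/-- **(Φ-holo) FOR THE SYMMETRISED SLICE MAP** from (Φ₀-holo) + (Φ₀-size): at every occurring last coupling `g k`,
`Q ↦ 2⁻¹ • (Φ₀ k (g k) Q + star (Φ₀ k (g k) (star Q)))` is Fréchet-holomorphic on the table ball `‖Q‖ < r` (Ahlfors' symmetry principle
through `star`: `symmetrise_star_lp_ball` (i)). [folklore] -/
theorem differentiableOn_symSlice (hd : ∀ k, ∀ g ∈ W, DifferentiableOn ℂ (Φ₀ k (g k)) (ball (0 : lp (fun _ : ι => ℂ) ∞) r))
    (hb : ∀ k, ∀ g ∈ W, MapsTo (Φ₀ k (g k)) (ball (0 : lp (fun _ : ι => ℂ) ∞) r) (closedBall 0 B₀)) :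
    ∀ k, ∀ g ∈ W, DifferentiableOn ℂ (fun Q => (2⁻¹ : ℂ) • (Φ₀ k (g k) Q + star (Φ₀ k (g k) (star Q))))
      (ball (0 : lp (fun _ : ι => ℂ) ∞) r) := fun k g hg =>
  (symmetrise_star_lp_ball (hd k g hg) fun _ hQ => mem_closedBall_zero_iff.mp (hb k g hg hQ)).2.1

/-- **(Φ-size) FOR THE SYMMETRISED SLICE MAP, SAME `B₀`** (`star` is isometric: `symmetrise_star_lp_ball` (ii)). [folklore] -/
theorem mapsTo_symSlice (hd : ∀ k, ∀ g ∈ W, DifferentiableOn ℂ (Φ₀ k (g k)) (ball (0 : lp (fun _ : ι => ℂ) ∞) r))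
    (hb : ∀ k, ∀ g ∈ W, MapsTo (Φ₀ k (g k)) (ball (0 : lp (fun _ : ι => ℂ) ∞) r) (closedBall 0 B₀)) :
    ∀ k, ∀ g ∈ W, MapsTo (fun Q => (2⁻¹ : ℂ) • (Φ₀ k (g k) Q + star (Φ₀ k (g k) (star Q))))
      (ball (0 : lp (fun _ : ι => ℂ) ∞) r) (closedBall 0 B₀) :=
  fun k g hg Q hQ => mem_closedBall_zero_iff.mpr
    ((symmetrise_star_lp_ball (hd k g hg) fun _ hQ' => mem_closedBall_zero_iff.mp (hb k g hg hQ')).2.2.1 Q hQ)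

/-- **AT A RECORD TABLE THE SYMMETRISED SLICE MAP READS, COORDINATEWISE, THE REAL PART OF THE NAIVE ONE**: `reading wt Q` is
self-adjoint (`isSelfAdjoint_reading`), so `(2⁻¹ • (Φ Q′ + star (Φ (star Q′)))) p = ((Φ Q′ p).re : ℂ)` at `Q′ := reading wt Q`
(`symmetrise_star_apply_of_isSelfAdjoint`).  No holomorphy is used. [folklore] -/
theorem symSlice_reading_apply (Φ : lp (fun _ : ι => ℂ) ∞ → lp (fun _ : Bg × C.Dom => ℂ) ∞) (wt : ι → ℝ) (Q : ι → ℝ)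
    (p : Bg × C.Dom) :
    ((2⁻¹ : ℂ) • (Φ (reading wt Q) + star (Φ (star (reading wt Q)))) : Bg × C.Dom → ℂ) p =
      (((Φ (reading wt Q) : Bg × C.Dom → ℂ) p).re : ℂ) :=
  symmetrise_star_apply_of_isSelfAdjoint Φ (isSelfAdjoint_reading wt Q) p

/-- … and the value there is itself a self-adjoint (= real-coordinate) vector of the slice space. [folklore] -/
theorem isSelfAdjoint_symSlice_reading (Φ : lp (fun _ : ι => ℂ) ∞ → lp (fun _ : Bg × C.Dom => ℂ) ∞) (wt : ι → ℝ)
    (Q : ι → ℝ) : IsSelfAdjoint ((2⁻¹ : ℂ) • (Φ (reading wt Q) + star (Φ (star (reading wt Q))))) :=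
  isSelfAdjoint_symmetrise Φ (isSelfAdjoint_reading wt Q)

/-- **The symmetrised slice map is `star`-EQUIVARIANT everywhere** (Ahlfors' `f(z) = \overline{f(z̄)}`) — the hypothesis under which
K2♭'s future-influence orbit stays real (`NE9FutureProfileReal.isSelfAdjoint_emb_of_star_comm`). [folklore] -/
theorem symSlice_star (Φ : lp (fun _ : ι => ℂ) ∞ → lp (fun _ : Bg × C.Dom => ℂ) ∞) (Q : lp (fun _ : ι => ℂ) ∞) :
    (2⁻¹ : ℂ) • (Φ (star Q) + star (Φ (star (star Q)))) = star ((2⁻¹ : ℂ) • (Φ Q + star (Φ (star Q)))) :=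
  (symmetrise_star Φ Q).symm

end Clauses

/-! ## §2 (Φ-real) and the END of record for the symmetrised naive complexification -/

section Record

variable {E : Functional C Bg} {W : Set (ℕ → ℝ)} {Adm : Set (Bg → C.Dom → ℝ)}
  {T : ℕ → (ℕ → ℝ) → (Bg → C.Dom → ℝ) → ι → ℝ} {Ψ : ℕ → ℝ → (ι → ℝ) → Bg → C.Dom → ℝ}
  {κ : ℝ} {wt : ℕ → ι → ℝ} {τ : ℕ → ℕ → ℝ} {τbar ω ωh : ℝ}

/-- **(Φ-real) OF THE END OF RECORD FOR THE SYMMETRISED SLICE MAP, from (Φ₀-re)**: if at the record's tables inside the ball the REAL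
PARTS of `Φ₀`'s coordinates are the record's new slice `e^{κd(X)}·(Ψ k (s k) (T k s (E g)))↾(k+1) U X`, then the symmetrised map takes
there exactly the (real) values the END of record asks for.  The imaginary parts of `Φ₀` at real tables are FREE. [folklore] -/
theorem hreal_symSlice {Φ₀ : ℕ → ℝ → lp (fun _ : ι => ℂ) ∞ → lp (fun _ : Bg × C.Dom => ℂ) ∞} {r : ℝ}
    (hre : ∀ k, ∀ g ∈ W, ∀ s ∈ W, reading (wt k) (T k s (E g)) ∈ ball (0 : lp (fun _ : ι => ℂ) ∞) r →
      ∀ (U : Bg) (X : C.Dom), ((Φ₀ k (s k) (reading (wt k) (T k s (E g))) : Bg × C.Dom → ℂ) (U, X)).re =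
        Real.exp (κ * C.d X) * restrictScale (k + 1) (Ψ k (s k) (T k s (E g))) U X) :
    ∀ k, ∀ g ∈ W, ∀ s ∈ W, reading (wt k) (T k s (E g)) ∈ ball (0 : lp (fun _ : ι => ℂ) ∞) r →
      ∀ (U : Bg) (X : C.Dom),
        ((2⁻¹ : ℂ) • (Φ₀ k (s k) (reading (wt k) (T k s (E g))) +
            star (Φ₀ k (s k) (star (reading (wt k) (T k s (E g)))))) : Bg × C.Dom → ℂ) (U, X) =
          ((Real.exp (κ * C.d X) * restrictScale (k + 1) (Ψ k (s k) (T k s (E g))) U X : ℝ) : ℂ) :=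
  fun k g hg s hs hQ U X => by rw [symSlice_reading_apply, hre k g hg s hs hQ U X]

/-- The special case a holomorphic EXTENSION delivers: if `Φ₀`'s values at the record's tables ARE the real vectors (coordinates
`((e^{κd(X)}·… : ℝ) : ℂ)`), then (Φ₀-re) holds. [folklore] -/
theorem re_of_eq_ofReal {Φ₀ : ℕ → ℝ → lp (fun _ : ι => ℂ) ∞ → lp (fun _ : Bg × C.Dom => ℂ) ∞} {r : ℝ}
    (hext : ∀ k, ∀ g ∈ W, ∀ s ∈ W, reading (wt k) (T k s (E g)) ∈ ball (0 : lp (fun _ : ι => ℂ) ∞) r →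
      ∀ (U : Bg) (X : C.Dom), (Φ₀ k (s k) (reading (wt k) (T k s (E g))) : Bg × C.Dom → ℂ) (U, X) =
        ((Real.exp (κ * C.d X) * restrictScale (k + 1) (Ψ k (s k) (T k s (E g))) U X : ℝ) : ℂ)) :
    ∀ k, ∀ g ∈ W, ∀ s ∈ W, reading (wt k) (T k s (E g)) ∈ ball (0 : lp (fun _ : ι => ℂ) ∞) r →
      ∀ (U : Bg) (X : C.Dom), ((Φ₀ k (s k) (reading (wt k) (T k s (E g))) : Bg × C.Dom → ℂ) (U, X)).re =
        Real.exp (κ * C.d X) * restrictScale (k + 1) (Ψ k (s k) (T k s (E g))) U X :=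
  fun k g hg s hs hQ U X => by rw [hext k g hg s hs hQ U X, Complex.ofReal_re]

/-- **ROUTE R4's END OF RECORD FOR THE SYMMETRISED NAIVE COMPLEXIFICATION.**  For a functional `E` with base-free histories (`h0`),
the END of record's structural binders `AdmissibleTerms`∕`AdmRestrict`∕`ChannelAdditive`∕`ChannelLocal`∕`ChannelSizeAtStepNN` (geometric
weights `τ k j ≤ τ̄ω^{k−j}`)∕`Factorises`∕`LastCouplingLipschitz` (moduli `lam k ≤ ℓ`), the admissible class closed under real scalars,
positive table weights, and ONE NAIVE complex slice map `Φ₀ k s : lp (ι → ℂ) ∞ → lp (Bg × C.Dom → ℂ) ∞` that is (Φ₀-holo)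
Fréchet-holomorphic and (Φ₀-size) `B₀`-bounded on the table ball `‖Q‖ < r` at every occurring last coupling, and (Φ₀-re) whose
coordinates' REAL PARTS at the record's tables are the record's new slice, with the ROOM `ω̂·r + (√2·τ̄)·B₀ ≤ θ·r`, `0 < θ < 1`, `ω ≤ ω̂`:
`NE9 E W κ (prodModuli ((2∕(1−θ))·ℓ) (fun _ => 2θ∕(1+θ))) ∧ FadingMemory ((2∕(1−θ))·ℓ ∕ (2θ∕(1+θ))) (2θ∕(1+θ)) (…)`.  Proof: the
owner's `NE9FutureProfileEndOfRecord.ne9_and_fadingMemory_of_holoSlice` at `ΦY k s Q := 2⁻¹ • (Φ₀ k s Q + star (Φ₀ k s (star Q)))` with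
§1's three clause adapters.  «NE9 ⇐ the named binders»: (Φ₀-holo)∕(Φ₀-size) are the INSTANCE ((R-0)[scope] + (♮)(♭)); W1 = model
O-NE9-1 untouched. [cite: Balaban1987RG1, (2.13) p.268; Balaban1988RG2Cluster, (1.36) p.9] -/
theorem ne9_and_fadingMemory_of_naiveSlice [Nonempty ι]
    (h0 : ∀ g ∈ W, ∀ (U : Bg) (X : C.Dom), C.scale X = 0 → E g U X = 0)
    (hAdm : AdmissibleTerms E W Adm) (hres : AdmRestrict Adm) (hadd : ChannelAdditive Adm T) (hloc : ChannelLocal Adm T)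
    (hstep : ChannelSizeAtStepNN Adm T κ wt τ) (hfac : Factorises E W T Ψ) {lam : ℕ → ℝ}
    (hlast : LastCouplingLipschitz E W T Ψ κ lam)
    (hsmul : ∀ (c : ℝ), ∀ H ∈ Adm, c • H ∈ Adm) (hne : Adm.Nonempty) (hwt : ∀ m y, 0 < wt m y)
    (hτ : ∀ k j, j ≤ k → 0 ≤ τ k j ∧ τ k j ≤ τbar * ω ^ (k - j)) (hτbar : 0 < τbar) (hω : 0 ≤ ω) (hωh : 0 < ωh)
    (hωωh : ω ≤ ωh) {Φ₀ : ℕ → ℝ → lp (fun _ : ι => ℂ) ∞ → lp (fun _ : Bg × C.Dom => ℂ) ∞} {r B₀ θ ℓ : ℝ} (hr : 0 < r)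
    (hB₀ : 0 ≤ B₀) (hθ0 : 0 < θ) (hθ1 : θ < 1) (hℓ : 0 ≤ ℓ)
    (hΦ₀d : ∀ k, ∀ g ∈ W, DifferentiableOn ℂ (Φ₀ k (g k)) (ball (0 : lp (fun _ : ι => ℂ) ∞) r))
    (hΦ₀b : ∀ k, ∀ g ∈ W, MapsTo (Φ₀ k (g k)) (ball (0 : lp (fun _ : ι => ℂ) ∞) r) (closedBall 0 B₀))
    (hΦ₀re : ∀ k, ∀ g ∈ W, ∀ s ∈ W, reading (wt k) (T k s (E g)) ∈ ball (0 : lp (fun _ : ι => ℂ) ∞) r →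
      ∀ (U : Bg) (X : C.Dom), ((Φ₀ k (s k) (reading (wt k) (T k s (E g))) : Bg × C.Dom → ℂ) (U, X)).re =
        Real.exp (κ * C.d X) * restrictScale (k + 1) (Ψ k (s k) (T k s (E g))) U X)
    (hroom : ωh * r + Real.sqrt 2 * τbar * B₀ ≤ θ * r) (hlam : ∀ k, lam k ≤ ℓ) :
    NE9 E W κ (prodModuli (2 / (1 - θ) * ℓ) fun _ => 2 * θ / (1 + θ)) ∧
      FadingMemory (2 / (1 - θ) * ℓ / (2 * θ / (1 + θ))) (2 * θ / (1 + θ))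
        (prodModuli (2 / (1 - θ) * ℓ) fun _ => 2 * θ / (1 + θ)) :=
  ne9_and_fadingMemory_of_holoSlice h0 hAdm hres hadd hloc hstep hfac hlast hsmul hne hwt hτ hτbar hω hωh hωωh
    (ΦY := fun k s Q => (2⁻¹ : ℂ) • (Φ₀ k s Q + star (Φ₀ k s (star Q)))) hr hB₀ hθ0 hθ1 hℓ
    (differentiableOn_symSlice hΦ₀d hΦ₀b) (mapsTo_symSlice hΦ₀d hΦ₀b) (hreal_symSlice hΦ₀re) hroom hlam

/-- … the same END under the STRONGER, extension-type reality clause «`Φ₀`'s values at the record's tables ARE the real slice vectors»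
(`re_of_eq_ofReal`). [folklore] -/
theorem ne9_and_fadingMemory_of_naiveSlice_ext [Nonempty ι]
    (h0 : ∀ g ∈ W, ∀ (U : Bg) (X : C.Dom), C.scale X = 0 → E g U X = 0)
    (hAdm : AdmissibleTerms E W Adm) (hres : AdmRestrict Adm) (hadd : ChannelAdditive Adm T) (hloc : ChannelLocal Adm T)
    (hstep : ChannelSizeAtStepNN Adm T κ wt τ) (hfac : Factorises E W T Ψ) {lam : ℕ → ℝ}
    (hlast : LastCouplingLipschitz E W T Ψ κ lam)
    (hsmul : ∀ (c : ℝ), ∀ H ∈ Adm, c • H ∈ Adm) (hne : Adm.Nonempty) (hwt : ∀ m y, 0 < wt m y)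
    (hτ : ∀ k j, j ≤ k → 0 ≤ τ k j ∧ τ k j ≤ τbar * ω ^ (k - j)) (hτbar : 0 < τbar) (hω : 0 ≤ ω) (hωh : 0 < ωh)
    (hωωh : ω ≤ ωh) {Φ₀ : ℕ → ℝ → lp (fun _ : ι => ℂ) ∞ → lp (fun _ : Bg × C.Dom => ℂ) ∞} {r B₀ θ ℓ : ℝ} (hr : 0 < r)
    (hB₀ : 0 ≤ B₀) (hθ0 : 0 < θ) (hθ1 : θ < 1) (hℓ : 0 ≤ ℓ)
    (hΦ₀d : ∀ k, ∀ g ∈ W, DifferentiableOn ℂ (Φ₀ k (g k)) (ball (0 : lp (fun _ : ι => ℂ) ∞) r))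
    (hΦ₀b : ∀ k, ∀ g ∈ W, MapsTo (Φ₀ k (g k)) (ball (0 : lp (fun _ : ι => ℂ) ∞) r) (closedBall 0 B₀))
    (hΦ₀ext : ∀ k, ∀ g ∈ W, ∀ s ∈ W, reading (wt k) (T k s (E g)) ∈ ball (0 : lp (fun _ : ι => ℂ) ∞) r →
      ∀ (U : Bg) (X : C.Dom), (Φ₀ k (s k) (reading (wt k) (T k s (E g))) : Bg × C.Dom → ℂ) (U, X) =
        ((Real.exp (κ * C.d X) * restrictScale (k + 1) (Ψ k (s k) (T k s (E g))) U X : ℝ) : ℂ))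
    (hroom : ωh * r + Real.sqrt 2 * τbar * B₀ ≤ θ * r) (hlam : ∀ k, lam k ≤ ℓ) :
    NE9 E W κ (prodModuli (2 / (1 - θ) * ℓ) fun _ => 2 * θ / (1 + θ)) ∧
      FadingMemory (2 / (1 - θ) * ℓ / (2 * θ / (1 + θ))) (2 * θ / (1 + θ))
        (prodModuli (2 / (1 - θ) * ℓ) fun _ => 2 * θ / (1 + θ)) :=
  ne9_and_fadingMemory_of_naiveSlice h0 hAdm hres hadd hloc hstep hfac hlast hsmul hne hwt hτ hτbar hω hωh hωωh hr hB₀ hθ0 hθ1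
    hℓ hΦ₀d hΦ₀b (re_of_eq_ofReal hΦ₀ext) hroom hlam

end Record

/-! ## §T Sanity -/

/-- (Φ₀-re) is STRICTLY WEAKER than «Φ₀ real at real tables»: the naive complexification `Φ₀ := I • id` of the ZERO slice map (one
`Unit` table coordinate, values in the same space) has real parts `0` at every real table although `Φ₀ Q ≠ 0` there — and its
symmetrisation VANISHES at real tables, as (Φ-real) then demands. [folklore] -/
example (Q : lp (fun _ : Unit => ℂ) ∞) (hQ : IsSelfAdjoint Q) (u : Unit) :
    (((2⁻¹ : ℂ) • ((Complex.I • Q) + star (Complex.I • star Q)) : lp (fun _ : Unit => ℂ) ∞) u) = 0 := by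
  have h := symmetrise_star_apply_of_isSelfAdjoint (fun P : lp (fun _ : Unit => ℂ) ∞ => Complex.I • P) hQ u
  simp only at h
  rw [h, lp.coeFn_smul, Pi.smul_apply, smul_eq_mul]
  have him : ((Q : Unit → ℂ) u).im = 0 := by
    have h2 := congrArg Complex.im (((isSelfAdjoint_lp_iff Q).mp hQ) u)
    rw [Complex.conj_im] at h2
    linarith
  simp [Complex.mul_re, him]

/-- NON-VACUITY of §1's clause adapters: the CONSTANT naive slice map `Φ₀ := fun _ _ _ => G₀` with `‖G₀‖ ≤ B₀` meets (Φ₀-holo) and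
(Φ₀-size) on every ball, so its symmetrisation `Q ↦ 2⁻¹ • (G₀ + star G₀)` is holomorphic and `B₀`-bounded there. [folklore] -/
example (W : Set (ℕ → ℝ)) (r : ℝ) {B₀ : ℝ} (G₀ : lp (fun _ : Bg × C.Dom => ℂ) ∞) (hG₀ : ‖G₀‖ ≤ B₀) :
    (∀ k : ℕ, ∀ g ∈ W, DifferentiableOn ℂ (fun _ : lp (fun _ : ι => ℂ) ∞ => (2⁻¹ : ℂ) • (G₀ + star G₀)) (ball 0 r)) ∧
      ∀ k : ℕ, ∀ g ∈ W, MapsTo (fun _ : lp (fun _ : ι => ℂ) ∞ => (2⁻¹ : ℂ) • (G₀ + star G₀)) (ball 0 r) (closedBall 0 B₀) :=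
  ⟨differentiableOn_symSlice (Φ₀ := fun (_ : ℕ) (_ : ℝ) (_ : lp (fun _ : ι => ℂ) ∞) => G₀) (W := W)
      (fun _ _ _ => differentiableOn_const _) (fun _ _ _ _ _ => mem_closedBall_zero_iff.mpr hG₀),
    mapsTo_symSlice (Φ₀ := fun (_ : ℕ) (_ : ℝ) (_ : lp (fun _ : ι => ℂ) ∞) => G₀) (W := W)
      (fun _ _ _ => differentiableOn_const _) (fun _ _ _ _ _ => mem_closedBall_zero_iff.mpr hG₀)⟩

end Summit.QuantumFields.BalabanUV.T4Continuum.NE9HoloSliceOfNaive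

end
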